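import Literature.NumberTheory.Automorphic.QuaternionAlgebraCentralizer
import Literature.NumberTheory.Automorphic.DivisionAlgebraAdelicCompact
import Mathlib.Algebra.Algebra.Subalgebra.Centralizer
import Mathlib.RingTheory.Flat.Basic
import HarnessLib

/-!
# The tori of `D^×`: the adelic centraliser of a regular element and the compactness of
`K(γ)_𝔸^× ⧸ ℝ_{>0} K(γ)^×`
(Gelbart, *Automorphic forms on adele groups* (1975), Remark 9.23; Vignéras, LNM 800, Ch. III §1)

Topic `NumberTheory/Automorphic`. For the trace formula of the multiplicative group of a
division quaternion algebra `D` over a number field `K` (Gelbart (1975), Remark 9.23, (10.14)) the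
non-central conjugacy classes `[γ]` of `Dˣ` contribute orbital integrals over
`G_γ \ G(𝔸)`, `G_γ = C_{D_𝔸ˣ}(γ)`, weighted by `vol(Γ(γ) A \ G_γ)`; one needs that `G_γ` is the
adelic torus `K(γ)_𝔸ˣ = (𝔸_K ⊗_K K(γ))ˣ`, abelian, and that `G_γ ⧸ (A_G · Dˣ ∩ G_γ)` is
compact. This file PROVES these facts:

* `ScalarExtension.mapRight K R f : D'_R →ₐ[R] D_R` (**definition**: functoriality of
  `D ↦ R ⊗_K D` in the algebra, Mathlib `Algebra.TensorProduct.map id f`), with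
  `mapRight_incl`, `mapRight_algebraMap`, injectivity for injective `f` (flatness over a field),
  continuity for the module topologies, and `ScalarExtension.mul_comm_of_comm` (`R ⊗ D'` is
  commutative for commutative `D'`);
* `unitsMapRight K D f : D'_𝔸ˣ →* D_𝔸ˣ` (**definition**, `Units.map`), continuous, compatible
  with `posRealCentral` and `inclAdelic`, hence mapping `ℝ_{>0} · D'ˣ` into `ℝ_{>0} · Dˣ`
  (`map_quotientSubgroup_units_le`);
* for a central `K`-algebra `D` of dimension `4` with all non-zero elements invertible and
  `γ ∈ Dˣ ∖ K`, with `T = C_D(γ) = K[γ]` (`QuaternionAlgebraCentralizer`):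
  `centralizer_comm`, `forall_isUnit_centralizer` (`T` is a field),
  `centralizer_inclAdelic_eq_range` — **`C_{D_𝔸ˣ}(γ) = (𝔸_K ⊗_K T)ˣ`** (image of
  `unitsMapRight K D T.val`; Mathlib's `Subalgebra.centralizer_coe_image_includeRight_eq_center_tensorProduct`
  for the inclusion `⊆`), `centralizer_inclAdelic_comm` (it is abelian), and
  `compactSpace_centralizer_quotient` — **`G_γ ⧸ (ℝ_{>0} Dˣ ∩ G_γ)` is compact**, as the
  continuous image of the compact `T_𝔸ˣ ⧸ ℝ_{>0} Tˣ` (Fujisaki for the field `T`,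
  `AdelicGroupData.compactSpace_automorphicQuotient_units_of_forall_isUnit`).

Part of the inline (D-0026) decomposition of
`Literature.NumberTheory.Automorphic.strong_multiplicity_one_quaternionUnits`: these discharge,
for the regular classes, the per-class hypotheses of
`AdelicGroupData.integral_quotientKernel_diag_eq_mul_tsum` (`AutomorphicQuotientKernelGeometric`).

## References

* S. Gelbart, *Automorphic forms on adele groups*, Ann. of Math. Studies 83 (1975), Remark 9.23
  [Gelbart1975].
* M.-F. Vignéras, *Arithmétique des algèbres de quaternions*, LNM 800 (1980), Ch. I §1,
  Ch. III §1 Thm. 1.4 [VignerasLNM800].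
-/

noncomputable section

open NumberField IsDedekindDomain Topology
open scoped TensorProduct NNReal

namespace Literature.NumberTheory.Automorphic

universe u v

/-! ### Functoriality of scalar extension in the algebra -/

namespace ScalarExtension

variable (K : Type*) [Field K] (R : Type*) [CommRing R] [Algebra K R]
  {D : Type*} [Ring D] [Algebra K D] {D' : Type*} [Ring D'] [Algebra K D']

/-- **Functoriality of `D ↦ D_R = R ⊗_K D`**: a `K`-algebra map `f : D' → D` induces the
`R`-algebra map `mapRight f = id_R ⊗ f : D'_R → D_R` (Mathlib `Algebra.TensorProduct.map`). Used
for the inclusion of the torus `K(γ)_𝔸 ↪ D_𝔸`. [folklore] -/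
def mapRight (f : D' →ₐ[K] D) : ScalarExtension K R D' →ₐ[R] ScalarExtension K R D :=
  (Algebra.TensorProduct.map (AlgHom.id R R) f : R ⊗[K] D' →ₐ[R] R ⊗[K] D)

/-- `mapRight f (r ⊗ x) = r ⊗ f x`. [folklore] -/
theorem mapRight_tmul (f : D' →ₐ[K] D) (r : R) (x : D') :
    mapRight K R f (ofTensor K R D' (r ⊗ₜ[K] x)) = ofTensor K R D (r ⊗ₜ[K] f x) :=
  Algebra.TensorProduct.map_tmul _ _ _ _

/-- `mapRight f (1 ⊗ x) = 1 ⊗ f x`: compatibility with the diagonal embeddings. [folklore] -/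
@[simp]
theorem mapRight_incl (f : D' →ₐ[K] D) (x : D') :
    mapRight K R f (incl K R D' x) = incl K R D (f x) :=
  Algebra.TensorProduct.map_tmul _ _ _ _

/-- `mapRight f` is the identity on `R ⊗ 1`. [folklore] -/
@[simp]
theorem mapRight_algebraMap (f : D' →ₐ[K] D) (r : R) :
    mapRight K R f (algebraMap R (ScalarExtension K R D') r) =
      algebraMap R (ScalarExtension K R D) r :=
  AlgHom.commutes _ r

/-- `mapRight f` is injective for injective `f` (`R` is flat over the field `K`; Mathlib
`Module.Flat.lTensor_preserves_injective_linearMap`). [folklore] -/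
theorem mapRight_injective (f : D' →ₐ[K] D) (hf : Function.Injective f) :
    Function.Injective (mapRight K R f) := by
  have h : (mapRight K R f : ScalarExtension K R D' → ScalarExtension K R D) =
      (LinearMap.lTensor R f.toLinearMap : R ⊗[K] D' → R ⊗[K] D) := by
    funext z
    change Algebra.TensorProduct.map (AlgHom.id R R) f z = LinearMap.lTensor R f.toLinearMap z
    induction z using TensorProduct.induction_on with
    | zero => simp only [map_zero]
    | tmul r x => rw [Algebra.TensorProduct.map_tmul, LinearMap.lTensor_tmul]; rfl
    | add a b ha hb => rw [map_add, map_add, ha, hb]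
  rw [h]
  exact Module.Flat.lTensor_preserves_injective_linearMap _ hf

/-- `R ⊗_K D'` is commutative when `D'` is. [folklore] -/
theorem mul_comm_of_comm (hcomm : ∀ x y : D', x * y = y * x) (a b : ScalarExtension K R D') :
    a * b = b * a := by
  change (show R ⊗[K] D' from a) * (show R ⊗[K] D' from b) =
    (show R ⊗[K] D' from b) * (show R ⊗[K] D' from a)
  generalize (show R ⊗[K] D' from a) = a'
  generalize (show R ⊗[K] D' from b) = b'
  induction a' using TensorProduct.induction_on with
  | zero => simp only [zero_mul, mul_zero]
  | tmul r x =>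
    induction b' using TensorProduct.induction_on with
    | zero => simp only [zero_mul, mul_zero]
    | tmul s y => rw [Algebra.TensorProduct.tmul_mul_tmul, Algebra.TensorProduct.tmul_mul_tmul,
        mul_comm r s, hcomm x y]
    | add c d hc hd => rw [mul_add, add_mul, hc, hd]
  | add c d hc hd => rw [add_mul, mul_add, hc, hd]

variable [TopologicalSpace R]

/-- `mapRight f` is continuous for the module topologies (an `R`-linear map out of a module
topology; Mathlib `IsModuleTopology.continuous_of_linearMap`). [folklore] -/
theorem continuous_mapRight [Module.Finite K D'] [Module.Finite K D] (f : D' →ₐ[K] D) :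
    Continuous (mapRight K R f) :=
  IsModuleTopology.continuous_of_linearMap (mapRight K R f).toLinearMap

end ScalarExtension

/-! ### The induced map on adelic units

`D` and `D'` may live in different universes (`Type u`, `Type v`): the tori of `GL(2)` are
subalgebras of `M₂(K) : Type`, those of `D^×` subalgebras of `D : Type u`. -/

section Units

variable (K : Type) [Field K] [NumberField K] (D : Type u) [Ring D] [Algebra K D]
  {D' : Type v} [Ring D'] [Algebra K D']

/-- **The map `D'_𝔸ˣ →* D_𝔸ˣ` induced by a `K`-algebra map `D' → D`** (`Units.map` of
`ScalarExtension.mapRight`); for `D' = K(γ) ↪ D` the inclusion of the adelic torus. [folklore] -/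
def unitsMapRight (f : D' →ₐ[K] D) : adelicUnits K D' →* adelicUnits K D :=
  Units.map (ScalarExtension.mapRight K (AdeleRing (𝓞 K) K) f).toRingHom.toMonoidHom

/-- `unitsMapRight f u = mapRight f u` on underlying elements (definitional). [folklore] -/
@[simp]
theorem val_unitsMapRight (f : D' →ₐ[K] D) (u : adelicUnits K D') :
    ((unitsMapRight K D f u : adelicUnits K D) : ScalarExtension K (AdeleRing (𝓞 K) K) D) =
      ScalarExtension.mapRight K (AdeleRing (𝓞 K) K) f u := rfl

/-- `unitsMapRight f` is continuous (`D'`, `D` finite-dimensional). [folklore] -/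
theorem continuous_unitsMapRight [Module.Finite K D'] [Module.Finite K D] (f : D' →ₐ[K] D) :
    Continuous (unitsMapRight K D f) :=
  Continuous.units_map _ (ScalarExtension.continuous_mapRight K (AdeleRing (𝓞 K) K) f)

/-- `unitsMapRight f` fixes the central `ℝ_{>0}`: `posRealCentral K D' t ↦ posRealCentral K D t`.
[folklore] -/
@[simp]
theorem unitsMapRight_posRealCentral (f : D' →ₐ[K] D) (t : ℝ≥0ˣ) :
    unitsMapRight K D f (posRealCentral K D' t) = posRealCentral K D t := by
  ext1
  simp only [val_unitsMapRight, posRealCentral, MonoidHom.coe_comp, Function.comp_apply,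
    Units.coe_map, RingHom.toMonoidHom_eq_coe, MonoidHom.coe_coe]
  exact ScalarExtension.mapRight_algebraMap K (AdeleRing (𝓞 K) K) f _

/-- `unitsMapRight f (inclAdelic x) = inclAdelic (f x)`. [folklore] -/
@[simp]
theorem unitsMapRight_inclAdelic (f : D' →ₐ[K] D) (x : D'ˣ) :
    unitsMapRight K D f (inclAdelic K D' x) = inclAdelic K D (Units.map f.toRingHom.toMonoidHom x) := by
  ext1
  simp only [val_unitsMapRight, inclAdelic, Units.coe_map, RingHom.toMonoidHom_eq_coe,
    MonoidHom.coe_coe]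
  exact ScalarExtension.mapRight_incl K (AdeleRing (𝓞 K) K) f _

/-- **`unitsMapRight f` maps `ℝ_{>0} · D'ˣ` into `ℝ_{>0} · Dˣ`** (the subgroups divided out in
the automorphic quotients of `D'ˣ` and `Dˣ`). [folklore] -/
theorem map_quotientSubgroup_units_le [Module.Finite K D'] [Module.Finite K D]
    (f : D' →ₐ[K] D) :
    ((AdelicGroupData.units K D').quotientSubgroup).map (unitsMapRight K D f) ≤
      (AdelicGroupData.units K D).quotientSubgroup := by
  change (((posRealCentral K D').range ⊔ (inclAdelic K D').range).map (unitsMapRight K D f)) ≤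
    (posRealCentral K D).range ⊔ (inclAdelic K D).range
  rw [Subgroup.map_sup]
  refine sup_le_sup ?_ ?_
  · rintro _ ⟨_, ⟨t, rfl⟩, rfl⟩
    exact ⟨t, (unitsMapRight_posRealCentral K D f t).symm⟩
  · rintro _ ⟨_, ⟨x, rfl⟩, rfl⟩
    exact ⟨Units.map f.toRingHom.toMonoidHom x, (unitsMapRight_inclAdelic K D f x).symm⟩

end Units

/-! ### The torus of a regular element of a quaternion division algebra -/

section Torus

variable (K : Type) [Field K] [NumberField K] (D : Type u) [Ring D] [Algebra K D]
  [Algebra.IsCentral K D]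

omit [NumberField K] in
/-- `T = C_D(γ)` is commutative for `γ ∉ K` (it equals `K[γ]`,
`Subalgebra.centralizer_singleton_eq_adjoin`). [cite: VignerasLNM800, Ch. I §1] -/
theorem centralizer_comm (hD : ∀ x : D, x ≠ 0 → IsUnit x) (h4 : Module.finrank K D = 4)
    {γ : D} (hγ : γ ∉ (⊥ : Subalgebra K D)) :
    ∀ x ∈ Subalgebra.centralizer K ({γ} : Set D), ∀ y ∈ Subalgebra.centralizer K ({γ} : Set D),
      x * y = y * x := by
  rw [Subalgebra.centralizer_singleton_eq_adjoin hD h4 hγ]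
  exact Algebra.adjoin_singleton_comm (K := K) γ

omit [NumberField K] [Algebra.IsCentral K D] in
/-- Every non-zero element of `T = C_D(γ)` is a unit of `T` (inverses of elements commuting with
`γ` commute with `γ`). [folklore] -/
theorem forall_isUnit_centralizer (hD : ∀ x : D, x ≠ 0 → IsUnit x) (γ : D) :
    ∀ x : Subalgebra.centralizer K ({γ} : Set D), x ≠ 0 → IsUnit x := by
  intro x hx
  have hx0 : (x : D) ≠ 0 := fun h => hx (Subtype.ext h)
  obtain ⟨u, hu⟩ := hD _ hx0
  have hxγ : γ * (x : D) = (x : D) * γ := (Subalgebra.mem_centralizer_iff K).1 x.2 γ rfl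
  have hinv : ((u⁻¹ : Dˣ) : D) ∈ Subalgebra.centralizer K ({γ} : Set D) := by
    rw [Subalgebra.mem_centralizer_iff]
    intro g hg
    rw [Set.mem_singleton_iff] at hg
    subst hg
    rw [← hu] at hxγ
    -- `g u = u g` ⇒ `g u⁻¹ = u⁻¹ g`
    calc g * ((u⁻¹ : Dˣ) : D) = ((u⁻¹ : Dˣ) : D) * (u * g) * ((u⁻¹ : Dˣ) : D) := by
          rw [← mul_assoc, Units.inv_mul, one_mul]
      _ = ((u⁻¹ : Dˣ) : D) * (g * u) * ((u⁻¹ : Dˣ) : D) := by rw [hxγ]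
      _ = ((u⁻¹ : Dˣ) : D) * g := by rw [mul_assoc, mul_assoc, Units.mul_inv, mul_one]
  refine ⟨⟨x, ⟨_, hinv⟩, Subtype.ext ?_, Subtype.ext ?_⟩, rfl⟩
  · change (x : D) * ((u⁻¹ : Dˣ) : D) = 1
    rw [← hu, Units.mul_inv]
  · change ((u⁻¹ : Dˣ) : D) * (x : D) = 1
    rw [← hu, Units.inv_mul]

/-- **The adelic centraliser of a regular element is the adelic torus**: for `γ ∈ Dˣ ∖ K` in a
central `K`-algebra `D` of dimension `4` with all non-zero elements invertible, and
`T = C_D(γ) = K[γ]`, the centraliser of `γ` (diagonally embedded) in `D_𝔸ˣ = (𝔸_K ⊗_K D)ˣ` is the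
image of `T_𝔸ˣ = (𝔸_K ⊗_K T)ˣ` under `unitsMapRight K D T.val` (Gelbart (1975), Remark 9.23:
`G_γ = K(γ)_𝔸ˣ`; the inclusion `⊆` is Mathlib's
`Subalgebra.centralizer_coe_image_includeRight_eq_center_tensorProduct`, `C_{𝔸 ⊗ D}(1 ⊗ γ) =
𝔸 ⊗ C_D(γ)`, plus the injectivity of `𝔸 ⊗ T → 𝔸 ⊗ D` to lift units). [cite: Gelbart1975, Remark 9.23] -/
theorem centralizer_inclAdelic_eq_range (hD : ∀ x : D, x ≠ 0 → IsUnit x)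
    (h4 : Module.finrank K D = 4) (γ : Dˣ) (hγ : (γ : D) ∉ (⊥ : Subalgebra K D)) :
    Subgroup.centralizer ({inclAdelic K D γ} : Set (adelicUnits K D)) =
      (unitsMapRight K D (Subalgebra.centralizer K ({(γ : D)} : Set D)).val).range := by
  haveI : Nontrivial D := Module.nontrivial_of_finrank_pos (R := K) (by omega)
  haveI : FiniteDimensional K D := Module.finite_of_finrank_pos (by omega)
  set T := Subalgebra.centralizer K ({(γ : D)} : Set D) with hT
  set φ := unitsMapRight K D T.val with hφ
  have hTc := centralizer_comm K D hD h4 hγ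
  -- `γ` as an element of `T`, and the commutativity of `𝔸 ⊗ T`
  have hγT : (γ : D) ∈ T := (Subalgebra.mem_centralizer_iff K).2 fun g hg => by
    rw [Set.mem_singleton_iff] at hg; subst hg; rfl
  have hcommA := ScalarExtension.mul_comm_of_comm K (AdeleRing (𝓞 K) K)
    (D' := T) (fun x y => Subtype.ext (hTc x x.2 y y.2))
  have hinclγ : ((inclAdelic K D γ : adelicUnits K D) : ScalarExtension K (AdeleRing (𝓞 K) K) D) =
      ScalarExtension.mapRight K (AdeleRing (𝓞 K) K) T.val
        (ScalarExtension.incl K (AdeleRing (𝓞 K) K) T ⟨γ, hγT⟩) := by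
    rw [ScalarExtension.mapRight_incl]; rfl
  apply le_antisymm
  · -- `⊆`: a unit commuting with `1 ⊗ γ` lies in `𝔸 ⊗ T`, and so does its inverse
    intro u hu
    rw [Subgroup.mem_centralizer_iff] at hu
    simp only [Set.mem_singleton_iff, forall_eq] at hu
    -- underlying elements in the centraliser subalgebra
    -- the two versions of `id ⊗ T.val` (`𝔸`-linear and `K`-linear identity) agree
    have hagree : ∀ z : AdeleRing (𝓞 K) K ⊗[K] T,
        Algebra.TensorProduct.map (AlgHom.id (AdeleRing (𝓞 K) K) (AdeleRing (𝓞 K) K)) T.val z =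
          Algebra.TensorProduct.map (AlgHom.id K (AdeleRing (𝓞 K) K)) T.val z := by
      intro z
      induction z using TensorProduct.induction_on with
      | zero => simp only [map_zero]
      | tmul r x => rw [Algebra.TensorProduct.map_tmul, Algebra.TensorProduct.map_tmul]; rfl
      | add a b ha hb => rw [map_add, map_add, ha, hb]
    have key : ∀ v : adelicUnits K D, inclAdelic K D γ * v = v * inclAdelic K D γ →
        ∃ z : ScalarExtension K (AdeleRing (𝓞 K) K) T,
          ScalarExtension.mapRight K (AdeleRing (𝓞 K) K) T.val z = v := by
      intro v hv
      set v' : AdeleRing (𝓞 K) K ⊗[K] D :=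
        (show AdeleRing (𝓞 K) K ⊗[K] D from (v : ScalarExtension K (AdeleRing (𝓞 K) K) D))
        with hv'def
      have hv' : v' ∈ Subalgebra.centralizer K
          (Algebra.TensorProduct.includeRight '' ({(γ : D)} : Set D) :
            Set (AdeleRing (𝓞 K) K ⊗[K] D)) := by
        rw [Subalgebra.mem_centralizer_iff]
        rintro _ ⟨d, hd, rfl⟩
        rw [Set.mem_singleton_iff] at hd
        subst hd
        exact congrArg Units.val hv
      rw [Subalgebra.centralizer_coe_image_includeRight_eq_center_tensorProduct] at hv'
      obtain ⟨z, hz⟩ := (AlgHom.mem_range _).1 hv'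
      refine ⟨z, ?_⟩
      change Algebra.TensorProduct.map (AlgHom.id (AdeleRing (𝓞 K) K) (AdeleRing (𝓞 K) K))
        T.val z = v'
      rw [hagree, hz]
    obtain ⟨z, hz⟩ := key u hu
    have hu' : inclAdelic K D γ * u⁻¹ = u⁻¹ * inclAdelic K D γ := by
      calc inclAdelic K D γ * u⁻¹ = u⁻¹ * (u * inclAdelic K D γ) * u⁻¹ := by group
        _ = u⁻¹ * (inclAdelic K D γ * u) * u⁻¹ := by rw [hu]
        _ = u⁻¹ * inclAdelic K D γ := by group
    obtain ⟨z', hz'⟩ := key u⁻¹ hu'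
    have hinj := ScalarExtension.mapRight_injective K (AdeleRing (𝓞 K) K) T.val
      Subtype.val_injective
    have h1 : z * z' = 1 := hinj (by
      rw [map_mul, hz, hz', map_one, ← Units.val_mul, mul_inv_cancel, Units.val_one])
    have h2 : z' * z = 1 := hinj (by
      rw [map_mul, hz, hz', map_one, ← Units.val_mul, inv_mul_cancel, Units.val_one])
    exact ⟨⟨z, z', h1, h2⟩, Units.ext hz⟩
  · -- `⊇`: `𝔸 ⊗ T` is commutative and contains `1 ⊗ γ`
    rintro _ ⟨w, rfl⟩
    rw [Subgroup.mem_centralizer_iff]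
    simp only [Set.mem_singleton_iff, forall_eq]
    ext1
    rw [Units.val_mul, Units.val_mul, val_unitsMapRight, hinclγ, ← map_mul, ← map_mul, hcommA]

/-- **The adelic centraliser of a regular element is abelian** (it is the torus `K(γ)_𝔸ˣ`).
[cite: Gelbart1975, Remark 9.23] -/
theorem centralizer_inclAdelic_comm (hD : ∀ x : D, x ≠ 0 → IsUnit x)
    (h4 : Module.finrank K D = 4) (γ : Dˣ) (hγ : (γ : D) ∉ (⊥ : Subalgebra K D)) :
    ∀ x ∈ Subgroup.centralizer ({inclAdelic K D γ} : Set (adelicUnits K D)),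
      ∀ y ∈ Subgroup.centralizer ({inclAdelic K D γ} : Set (adelicUnits K D)), x * y = y * x := by
  rw [centralizer_inclAdelic_eq_range K D hD h4 γ hγ]
  rintro _ ⟨w, rfl⟩ _ ⟨w', rfl⟩
  rw [← map_mul, ← map_mul]
  congr 1
  ext1
  rw [Units.val_mul, Units.val_mul]
  exact ScalarExtension.mul_comm_of_comm K _
    (fun x y => Subtype.ext (centralizer_comm K D hD h4 hγ x x.2 y y.2)) _ _

/-- **Compactness of `G_γ ⧸ (ℝ_{>0} Dˣ ∩ G_γ)` for a regular `γ`** (Gelbart (1975), Remark 9.23: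
the volumes `vol(Γ(γ) A \ G_γ)` are finite, `G_γ = K(γ)_𝔸ˣ` being the idele group of the
quadratic field `K(γ)` and `K(γ)_𝔸ˣ ⧸ ℝ_{>0} K(γ)ˣ` compact). For a central `K`-algebra `D` of
dimension `4` over a number field with all non-zero elements invertible and `γ ∈ Dˣ ∖ K`, the
quotient of `G_γ = C_{D_𝔸ˣ}(γ)` by its intersection with `ℝ_{>0} · Dˣ` is compact: it is the
continuous image of the automorphic quotient of the field `T = C_D(γ) = K[γ]`, compact by
Fujisaki's theorem (`AdelicGroupData.compactSpace_automorphicQuotient_units_of_forall_isUnit`),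
under the map induced by `unitsMapRight K D T.val`, which is onto `G_γ`
(`centralizer_inclAdelic_eq_range`) and maps `ℝ_{>0} · Tˣ` into `ℝ_{>0} · Dˣ`
(`map_quotientSubgroup_units_le`). [cite: Gelbart1975, Remark 9.23] -/
theorem compactSpace_centralizer_quotient [Module.Finite K D] (hD : ∀ x : D, x ≠ 0 → IsUnit x)
    (h4 : Module.finrank K D = 4) (γ : Dˣ) (hγ : (γ : D) ∉ (⊥ : Subalgebra K D)) :
    CompactSpace (↥(Subgroup.centralizer ({inclAdelic K D γ} : Set (adelicUnits K D))) ⧸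
      ((AdelicGroupData.units K D).quotientSubgroup ⊓
        Subgroup.centralizer ({inclAdelic K D γ} : Set (adelicUnits K D))).subgroupOf
        (Subgroup.centralizer ({inclAdelic K D γ} : Set (adelicUnits K D)))) := by
  haveI : Nontrivial D := Module.nontrivial_of_finrank_pos (R := K) (by omega)
  set T := Subalgebra.centralizer K ({(γ : D)} : Set D) with hT
  set Gγ := Subgroup.centralizer ({inclAdelic K D γ} : Set (adelicUnits K D)) with hG
  set M : Subgroup Gγ := ((AdelicGroupData.units K D).quotientSubgroup ⊓ Gγ).subgroupOf Gγ
    with hM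
  -- the torus `T_𝔸ˣ` and the compactness of its automorphic quotient (Fujisaki for the field `T`)
  have hc : CompactSpace (AdelicGroupData.units K T).automorphicQuotient :=
    AdelicGroupData.compactSpace_automorphicQuotient_units_of_forall_isUnit K T
      (forall_isUnit_centralizer K D hD (γ : D))
  haveI : CompactSpace (adelicUnits K T ⧸ (AdelicGroupData.units K T).quotientSubgroup) := hc
  set φ := unitsMapRight K D T.val with hφ
  have hrange : Gγ = φ.range := centralizer_inclAdelic_eq_range K D hD h4 γ hγ
  have hmem : ∀ w, φ w ∈ Gγ := fun w => by rw [hrange]; exact ⟨w, rfl⟩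
  -- `φ' : T_𝔸ˣ → G_γ`, continuous and onto
  set φ' : adelicUnits K T → Gγ := fun w => ⟨φ w, hmem w⟩ with hφ'
  have hφ'c : Continuous φ' := (continuous_unitsMapRight K D T.val).subtype_mk _
  have hφ's : Function.Surjective φ' := by
    rintro ⟨g, hg⟩
    rw [hrange] at hg
    obtain ⟨w, rfl⟩ := hg
    exact ⟨w, rfl⟩
  -- the induced map on the quotients
  have hcompat : ∀ a b : adelicUnits K T,
      QuotientGroup.leftRel (AdelicGroupData.units K T).quotientSubgroup a b →
        QuotientGroup.leftRel M (φ' a) (φ' b) := by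
    intro a b hab
    rw [QuotientGroup.leftRel_apply] at hab ⊢
    refine Subgroup.mem_subgroupOf.2 (Subgroup.mem_inf.2 ⟨?_, Gγ.mul_mem (Gγ.inv_mem (φ' a).2) (φ' b).2⟩)
    change (φ a)⁻¹ * φ b ∈ (AdelicGroupData.units K D).quotientSubgroup
    rw [← map_inv, ← map_mul]
    exact map_quotientSubgroup_units_le K D T.val ⟨a⁻¹ * b, hab, rfl⟩
  set ψ : adelicUnits K T ⧸ (AdelicGroupData.units K T).quotientSubgroup → Gγ ⧸ M :=
    Quotient.map' φ' hcompat with hψ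
  have hψc : Continuous ψ := by
    -- the quotient map of the torus datum is an open quotient map (instances keyed on the
    -- datum's own fields, as in `AdelicGroupData.continuous_toAutomorphicQuotient`)
    have hq : IsOpenQuotientMap (QuotientGroup.mk : (AdelicGroupData.units K T).Adelic →
        (AdelicGroupData.units K T).Adelic ⧸ (AdelicGroupData.units K T).quotientSubgroup) :=
      QuotientGroup.isOpenQuotientMap_mk
    have h : Continuous (ψ ∘ (QuotientGroup.mk : (AdelicGroupData.units K T).Adelic →
        (AdelicGroupData.units K T).Adelic ⧸ (AdelicGroupData.units K T).quotientSubgroup)) :=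
      (QuotientGroup.continuous_mk (N := M)).comp hφ'c
    exact hq.continuous_comp_iff.1 h
  have hψs : Function.Surjective ψ := by
    intro q
    induction q using QuotientGroup.induction_on with
    | H g =>
      obtain ⟨w, rfl⟩ := hφ's g
      exact ⟨QuotientGroup.mk w, rfl⟩
  exact hψs.compactSpace hψc

end Torus

end Literature.NumberTheory.Automorphic
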